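import Literature.NumberTheory.EllipticCurves.FormalGroupChart
import Literature.NumberTheory.EllipticCurves.MaxUnramifiedIntegersProofs
import Literature.NumberTheory.EllipticCurves.ReductionInertiaInvarianceProofs
import Literature.NumberTheory.EllipticCurves.GeomPointReduction
import Literature.NumberTheory.EllipticCurves.HasseWeilGoodReductionFrobeniusProofs
import Literature.NumberTheory.EllipticCurves.IsogenyDualProofs
import Literature.NumberTheory.EllipticCurves.FrobeniusTateModule
import HarnessLib

/-!
# Lang's theorem and Hensel lifting for the good model at a finite place:
# `m ≡ φ b - b (mod V₁)` with `b` fixed by inertia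

`Proofs` file (theorems only, no definitions, no named facts) in topic
`NumberTheory/EllipticCurves`, in the setting of `SelmerInertia` / `HasseWeilGoodReductionFrobeniusProofs`
§3: `K` a number field, `v` a finite place, `K_v = v.adicCompletion K`, `K̄_v = AlgebraicClosure K_v`
with its spectral valuation `w` (`hw`), `𝓞_v = v.adicCompletionIntegers K`, `𝒪_w = w.integer`,
`𝔐 ∈ v.localPrimesAbove` with inertia group `I_𝔐 ≤ Γ_{K_v}`, and for `E/K` with good reduction at
`v` the good minimal model `M = W.localMinimalIntegralModel v` over `𝓞_v` and
`V = (M ⊗ K_v) ⊗ K̄_v`.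

## Main results

* `IsDedekindDomain.HeightOneSpectrum.exists_rootOfUnity_spectralValuation_sub_lt_one`,
  `exists_residue_eq_forall_inertia`: Teichmüller representatives in `K̄_v` for `|·|_v`, hence
  every residue class of `𝒪_w` has an `I_𝔐`-invariant representative (Serre, *Local Fields*,
  IV §4 Prop. 16; Neukirch, *ANT*, II (9.9)).
* `IsDedekindDomain.HeightOneSpectrum.exists_isRoot_residue_eq_forall`: Hensel lifts of simple
  roots over `𝒪_w` exist (`henselianLocalRing_integer`) and are fixed by every isometric, inertial
  `K_v`-automorphism fixing the coefficients (uniqueness of Hensel lifts).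
* `Literature.NumberTheory.EllipticCurves.FormalGroupChart.mem_kernel_iff_reducesToZero`,
  `mem_kernel_iff_not_isIntegralPoint`: the subgroup `FormalGroupChart.kernel` is `E₁` in the
  language of `ReductionHomomorphism` / `PointReduction`.
* `WeierstrassCurve.exists_map_frob_sub_eq`: **Lang's theorem** `Ẽ(k₀) = (F - 1) Ẽ(k₀)` over any
  algebraic closure `k₀` of the finite field `k` (transport of the tree's
  `oneSubFrobeniusIsogeny` + `Isogeny.surjective`, *AEC* II.2.3, along `IsAlgClosure.equiv`).
* `WeierstrassCurve.isAlgebraic_residueField_integer`: `𝒪_w/𝔪_w` is algebraic over `k_v` (so an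
  algebraic closure of `k_v`, with `isAlgClosed_residueField_integer`).
* `WeierstrassCurve.exists_lift_sub_mem_kernel` (**main**): for `φ ∈ Γ_{K_v}` inducing
  `z ↦ z^{q_v}` modulo `𝔐` and every `m ∈ V(K̄_v)` there is `b ∈ V(K̄_v)` fixed by `I_𝔐` with
  `m - (φ b - b) ∈ V₁(K̄_v) = FormalGroupChart.kernel`. This is the "Lang's theorem + Hensel's
  lemma" step of Milne, *Arithmetic Duality Theorems*, proof of Prop. I.3.8
  (`H¹(K_v^nr/K_v, E(K_v^nr)) = 0` for good reduction), used for
  `Milne2006_unramifiedClass_eq_zero` (`PeriodIndexSupport`).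

## References

* J. S. Milne, *Arithmetic Duality Theorems*, 2nd ed. (2006), Ch. I, Prop. 3.8 and its proof.
* S. Lang, *Algebraic groups over finite fields*, Amer. J. Math. 78 (1956).
* J. H. Silverman, *The Arithmetic of Elliptic Curves*, 2nd ed., II.2.3, VII.2.1.
* J.-P. Serre, *Local Fields*, Ch. IV §4 Prop. 16 (Teichmüller representatives).
* J. Neukirch, *Algebraic Number Theory*, Ch. II §6 (Hensel), §9 (9.9).

## Design

`noncomputable section`, `open scoped Classical NNReal`. No new definitions: the reduction map
`V(K̄_v) → Ẽ(k₀)` is assembled inside the proof of the main theorem from the tree's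
`goodReductionHom` (`GeomPointReduction`) along `Affine.Point.congrEquiv`
(`hX : (M ⊗ K_v) ⊗ K̄_v = (M.map ι) ⊗ K̄_v`, `ι : 𝓞_v → 𝒪_w` from `MaxUnramifiedIntegersProofs`),
the `q`-Frobenius of `k₀` is Mathlib's `iterateFrobeniusEquiv` (with `q = p^n` from
`FiniteField.card'`), made `k_v`-linear by `FiniteField.pow_card`. Heartbeats are raised for the
main theorem only (one long transport proof). Axioms: `propext`, `Classical.choice`, `Quot.sound`.
-/

noncomputable section

open scoped Classical NNReal
open NumberField IsDedekindDomain Field Polynomial ValuativeRel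

universe u

namespace IsDedekindDomain.HeightOneSpectrum

open Literature.NumberTheory.EllipticCurves Literature.NumberTheory.GaloisRepresentations
  Literature.NumberTheory.GaloisRepresentations.IsNonarchimedeanLocalField

variable {K : Type u} [Field K] [NumberField K] {v : HeightOneSpectrum (𝓞 K)}
  {w : Valuation (AlgebraicClosure (v.adicCompletion K)) ℝ≥0}
  (hw : ∀ x, (w x : ℝ) = spectralNorm (v.adicCompletion K) (AlgebraicClosure (v.adicCompletion K)) x)

include hw

/-- **The structure map `𝓞_v → 𝒪_w`** from the integers of `K_v` to the valuation ring of the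
spectral valuation of `K̄_v` (through `𝒪ⁿʳ`: the tree's `exists_ringHom_adicCompletionIntegers_unrIntegers`
and `exists_ringHom_unrIntegers_integer`). [folklore] -/
theorem exists_ringHom_adicCompletionIntegers_integer :
    ∃ ι : v.adicCompletionIntegers K →+* w.integer,
      ∀ a, ((ι a : w.integer) : AlgebraicClosure (v.adicCompletion K)) =
        algebraMap (v.adicCompletion K) (AlgebraicClosure (v.adicCompletion K)) (a : v.adicCompletion K) := by
  obtain ⟨φ, hφ⟩ := exists_ringHom_adicCompletionIntegers_unrIntegers hw
  obtain ⟨ψ, hψ⟩ := exists_ringHom_unrIntegers_integer (w := w)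
  exact ⟨ψ.comp φ, fun a ↦ by rw [RingHom.comp_apply, hψ, hφ]⟩

/-- **Teichmüller representatives in `K̄_v`, spectral form.** Every `c ∈ K̄_v` with `|c|_v = 1`
is congruent modulo `𝔐 = {|·|_v < 1}` to a root of unity `ζ ∈ K̄_v` of order prime to `p`
(the tree's `exists_rootOfUnity_sub_mem_absMaximalIdeal`, Serre, *Local Fields*, IV §4 Prop. 16,
read through the identification of the unit balls of `|·|_v` and `algNorm K_v`); such a `ζ` lies in
`maxUnramified K_v` and is fixed by every inertia group `I_𝔐`.
[cite: SerreLocalFields1979, Ch. IV §4 Prop. 16] -/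
theorem exists_rootOfUnity_spectralValuation_sub_lt_one {𝔐 : Ideal v.localAbsIntegers}
    (h𝔐 : 𝔐 ∈ v.localPrimesAbove)
    {c : AlgebraicClosure (v.adicCompletion K)} (hc : w c = 1) :
    ∃ ζ : AlgebraicClosure (v.adicCompletion K), w ζ = 1 ∧ w (c - ζ) < 1 ∧
      (∃ N : ℕ, IsUnit ((N : ℕ) : 𝒪[v.adicCompletion K]) ∧ ζ ^ N = 1) ∧
      ∀ σ ∈ 𝔐.inertia (absoluteGaloisGroup (v.adicCompletion K)),
        absoluteGaloisGroup.toAlgEquiv (v.adicCompletion K) σ ζ = ζ := by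
  have hlt : ¬ w c < 1 := by rw [hc]; exact lt_irrefl 1
  have hxint : c ∈ absIntegers 𝒪[v.adicCompletion K] (v.adicCompletion K) := by
    rw [mem_absIntegers_iff_algNorm_le_one, ← spectralValuation_le_one_iff_algNorm_le_one hw]
    exact hc.le
  have hb𝔓 : (⟨c, hxint⟩ : absIntegers 𝒪[v.adicCompletion K] (v.adicCompletion K)) ∉
      absMaximalIdeal (v.adicCompletion K) := by
    rw [mem_absMaximalIdeal_iff_algNorm_lt_one, ← spectralValuation_lt_one_iff_algNorm_lt_one hw]
    exact hlt
  obtain ⟨N, ζ, hNu, hζN, hbζ⟩ := exists_rootOfUnity_sub_mem_absMaximalIdeal hb𝔓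
  have hxζ : w (c - (ζ : AlgebraicClosure (v.adicCompletion K))) < 1 := by
    rw [spectralValuation_lt_one_iff_algNorm_lt_one hw]
    have h := mem_absMaximalIdeal_iff_algNorm_lt_one.mp hbζ
    rwa [Subalgebra.coe_sub] at h
  have hζN' : (ζ : AlgebraicClosure (v.adicCompletion K)) ^ N = 1 := by
    have := congrArg Subtype.val hζN
    simpa using this
  have hN0 : N ≠ 0 := by
    rintro rfl
    rw [Nat.cast_zero] at hNu
    exact not_isUnit_zero hNu
  have hζ1 : w (ζ : AlgebraicClosure (v.adicCompletion K)) = 1 := by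
    have h := congrArg w hζN'
    rw [map_pow, map_one] at h
    exact (pow_eq_one_iff_of_nonneg zero_le hN0).mp h
  have hζmem : (ζ : AlgebraicClosure (v.adicCompletion K)) ∈ maxUnramified (v.adicCompletion K) :=
    IntermediateField.subset_adjoin _ _ ⟨N, hNu, hζN'⟩
  refine ⟨ζ, hζ1, hxζ, ⟨N, hNu, hζN'⟩, fun σ hσ ↦ ?_⟩
  exact (mem_maxUnramified_iff_forall_inertia hw h𝔐).mp hζmem σ hσ

/-- **Inertia-invariant lifts of residue classes.** Every element of the residue field of `𝒪_w`
(the valuation ring of `K̄_v`) is the residue of an element of `𝒪_w` fixed by the inertia group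
`I_𝔐` — namely `0` or a Teichmüller representative, which lies in `K_v^nr`, the fixed field of
`I_𝔐`. (Neukirch, *ANT*, II (9.9): the residue field of `K̄_v` is that of the maximal unramified
extension.) [cite: NeukirchANT1999, Ch. II §9 Prop. (9.9)] -/
theorem exists_residue_eq_forall_inertia {𝔐 : Ideal v.localAbsIntegers} (h𝔐 : 𝔐 ∈ v.localPrimesAbove)
    (γ : IsLocalRing.ResidueField w.integer) :
    ∃ a : w.integer, IsLocalRing.residue w.integer a = γ ∧
      ∀ σ ∈ 𝔐.inertia (absoluteGaloisGroup (v.adicCompletion K)),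
        absoluteGaloisGroup.toAlgEquiv (v.adicCompletion K) σ (a : AlgebraicClosure (v.adicCompletion K)) = a := by
  obtain ⟨c, rfl⟩ := IsLocalRing.residue_surjective γ
  rcases (show w (c : AlgebraicClosure (v.adicCompletion K)) ≤ 1 from c.2).eq_or_lt with hc1 | hclt
  · obtain ⟨ζ, hwζ, hcζ, -, hfix⟩ := exists_rootOfUnity_spectralValuation_sub_lt_one hw h𝔐 hc1
    refine ⟨⟨ζ, hwζ.le⟩, ?_, fun σ hσ ↦ hfix σ hσ⟩
    have := WeierstrassCurve.residue_eq_of_val_sub_lt_one (w := w) hwζ.le c.2 hcζ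
    exact this.symm
  · refine ⟨0, ?_, fun σ _ ↦ by simp⟩
    rw [map_zero, eq_comm, ← v_algebraMap_lt_one_iff (Valuation.integer.integers w)]
    exact hclt

omit hw in
/-- Evaluation of a polynomial over `K̄_v` commutes with a `K_v`-automorphism fixing its
coefficients. [folklore] -/
theorem algEquiv_eval_of_forall_coeff
    {σ : AlgebraicClosure (v.adicCompletion K) ≃ₐ[v.adicCompletion K] AlgebraicClosure (v.adicCompletion K)}
    {g : (AlgebraicClosure (v.adicCompletion K))[X]} (hg : ∀ i, σ (g.coeff i) = g.coeff i)
    (x : AlgebraicClosure (v.adicCompletion K)) : σ (g.eval x) = g.eval (σ x) := by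
  rw [eval_eq_sum_range, eval_eq_sum_range, map_sum]
  refine Finset.sum_congr rfl fun i _ ↦ ?_
  rw [map_mul, map_pow, hg]

omit hw in
/-- **Hensel lifts of simple roots are inertia-invariant.** Let `f ∈ 𝒪_w[X]` be monic and
`γ` a simple root of its reduction `f̄`. Then `f` has a root `a ∈ 𝒪_w` with residue `γ`
(`𝒪_w` is henselian, `henselianLocalRing_integer`), and every `K_v`-automorphism `σ` of `K̄_v`
which is a `|·|_v`-isometry, moves `w`-integers within their residue class and fixes the
coefficients of `f` fixes `a`: `σ a` is again a root of `f` congruent to `a`, and such a root is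
unique (`eq_of_isRoot_of_sub_mem_maximalIdeal`). Neukirch, *ANT*, II §6 (Hensel's lemma,
(6.6)–(6.8)). [cite: NeukirchANT1999, Ch. II §6 (4.6) (Hensel's lemma)] -/
theorem exists_isRoot_residue_eq_forall (f : (w.integer)[X]) (hf : f.Monic)
    (γ : IsLocalRing.ResidueField w.integer)
    (hγ : (f.map (IsLocalRing.residue w.integer)).IsRoot γ)
    (hγ' : (f.map (IsLocalRing.residue w.integer)).derivative.eval γ ≠ 0) :
    ∃ a : w.integer, f.IsRoot a ∧ IsLocalRing.residue w.integer a = γ ∧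
      ∀ σ : AlgebraicClosure (v.adicCompletion K) ≃ₐ[v.adicCompletion K]
          AlgebraicClosure (v.adicCompletion K),
        (∀ z, w (σ z) = w z) → (∀ z, w z ≤ 1 → w (σ z - z) < 1) →
        (∀ i, σ ((f.coeff i : w.integer) : AlgebraicClosure (v.adicCompletion K)) = f.coeff i) →
        σ (a : AlgebraicClosure (v.adicCompletion K)) = a := by
  haveI : IsAlgClosed (AlgebraicClosure (v.adicCompletion K)) := inferInstance
  haveI := henselianLocalRing_integer w
  have hv : w.Integers w.integer := Valuation.integer.integers w
  obtain ⟨b₁, rfl⟩ := IsLocalRing.residue_surjective γ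
  -- `f(b₁) ∈ 𝔪`, `f'(b₁)` is a unit
  have heval : ∀ g : (w.integer)[X], IsLocalRing.residue w.integer (g.eval b₁) =
      (g.map (IsLocalRing.residue w.integer)).eval (IsLocalRing.residue w.integer b₁) := fun g ↦ by
    rw [eval_map, ← eval₂_at_apply]
  have h₁ : f.eval b₁ ∈ IsLocalRing.maximalIdeal w.integer := by
    rw [← IsLocalRing.residue_eq_zero_iff, heval]; exact hγ
  have h₂ : IsUnit (f.derivative.eval b₁) := by
    apply isUnit_of_residue_ne_zero
    rw [heval, ← derivative_map]; exact hγ'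
  obtain ⟨a, ha, hab⟩ := HenselianLocalRing.is_henselian f hf b₁ h₁ h₂
  refine ⟨a, ha, ?_, fun σ hσ₁ hσ₂ hσf ↦ ?_⟩
  · rw [← sub_eq_zero, ← map_sub, IsLocalRing.residue_eq_zero_iff]; exact hab
  · -- `σ a` is a root of `f` congruent to `b₁`
    have hσa1 : w (σ (a : AlgebraicClosure (v.adicCompletion K))) ≤ 1 := (hσ₁ _).le.trans a.2
    set a' : w.integer := ⟨σ (a : AlgebraicClosure (v.adicCompletion K)), hσa1⟩ with ha'
    have hroot : f.IsRoot a' := by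
      rw [IsRoot.def]
      apply hv.hom_inj
      rw [map_zero, ← eval_map_algebraMap_integer]
      change (f.map (algebraMap w.integer (AlgebraicClosure (v.adicCompletion K)))).eval
        (σ (a : AlgebraicClosure (v.adicCompletion K))) = 0
      rw [← algEquiv_eval_of_forall_coeff (σ := σ) (fun i ↦ by rw [coeff_map]; exact hσf i),
        eval_map_algebraMap_integer, show f.eval a = 0 from ha, map_zero, map_zero]
    have hcong : a' - b₁ ∈ IsLocalRing.maximalIdeal w.integer := by
      have h1 : a' - a ∈ IsLocalRing.maximalIdeal w.integer := by
        rw [← IsLocalRing.residue_eq_zero_iff, ← v_algebraMap_lt_one_iff hv]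
        exact hσ₂ _ a.2
      have : a' - b₁ = (a' - a) + (a - b₁) := by ring
      rw [this]
      exact Ideal.add_mem _ h1 hab
    have hder : IsUnit (f.derivative.eval b₁) := h₂
    have := eq_of_isRoot_of_sub_mem_maximalIdeal f hroot ha hcong hab hder
    exact congrArg (fun z : w.integer ↦ (z : AlgebraicClosure (v.adicCompletion K))) this

end IsDedekindDomain.HeightOneSpectrum

/-! ## The bridge `FormalGroupChart.kernel` ↔ `WeierstrassCurve.ReducesToZero` -/

namespace Literature.NumberTheory.EllipticCurves.FormalGroupChart

variable {L : Type u} [Field L] {w : Valuation L ℝ≥0}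

/-- **`E₁` in the two renderings of the tree**: for a Weierstrass equation `W₀` over the valuation
ring `𝒪_w` of a valued field `(L, w)`, a point of `(W₀)_L` lies in the subgroup
`FormalGroupChart.kernel w (W₀)_L` (file `FormalGroupChart`: `O` and the affine points with
`|x| > 1`) iff it `ReducesToZero` in the sense of `ReductionHomomorphism` (`O` or `x ∉ 𝒪_w`).
[folklore] -/
theorem mem_kernel_iff_reducesToZero (W₀ : WeierstrassCurve w.integer)
    (P : (W₀.baseChange L).toAffine.Point) :
    (haveI : (W₀.baseChange L).IsIntegral w.integer := ⟨⟨W₀, rfl⟩⟩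
     P ∈ kernel w (W₀.baseChange L)) ↔ W₀.ReducesToZero P := by
  haveI : (W₀.baseChange L).IsIntegral w.integer := ⟨⟨W₀, rfl⟩⟩
  rcases P with _ | ⟨x, y, h⟩
  · exact ⟨fun _ ↦ trivial, fun _ ↦ (kernel w (W₀.baseChange L)).zero_mem⟩
  · rw [some_mem_kernel_iff, WeierstrassCurve.reducesToZero_some_iff,
      not_mem_range_iff (Valuation.integer.integers w)]

/-- The same bridge with `Literature.NumberTheory.EllipticCurves.IsIntegralPoint` (file
`PointReduction`): `P ∈ kernel ↔ P = O ∨ P` is not an integral point. [folklore] -/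
theorem mem_kernel_iff_not_isIntegralPoint {V : WeierstrassCurve L} [hV : V.IsIntegral w.integer]
    (P : V.toAffine.Point) : P ∈ kernel w V ↔ P = 0 ∨ ¬ IsIntegralPoint w P := by
  rcases P with _ | ⟨x, y, h⟩
  · exact ⟨fun _ ↦ Or.inl rfl, fun _ ↦ (kernel w V).zero_mem⟩
  · rw [some_mem_kernel_iff, isIntegralPoint_some_iff, not_le]
    exact ⟨fun hx ↦ Or.inr hx, fun hx ↦ hx.resolve_left (WeierstrassCurve.Affine.Point.some_ne_zero _)⟩

end Literature.NumberTheory.EllipticCurves.FormalGroupChart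

/-! ## Lang's theorem transported to the residue field of `K̄_v`, and the inertia-invariant lift -/

namespace WeierstrassCurve

open Literature.NumberTheory.EllipticCurves Literature.NumberTheory.GaloisRepresentations Field
  IsDedekindDomain.HeightOneSpectrum

variable {K : Type u} [Field K] [NumberField K] (W : WeierstrassCurve K)
  {v : HeightOneSpectrum (𝓞 K)}
  {w : Valuation (AlgebraicClosure (v.adicCompletion K)) ℝ≥0}
  (hw : ∀ x, (w x : ℝ) = spectralNorm (v.adicCompletion K) (AlgebraicClosure (v.adicCompletion K)) x)

/-- **Lang's theorem for the reduction, over any algebraically closed field `k₀ ⊇ k_v`**: for an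
elliptic curve `Ẽ` over the finite field `k_v` with `q` elements, a `k_v`-algebra `k₀` which is an
algebraic closure of `k_v`, and the `q`-power map `Fq ∈ Aut(k₀/k_v)`, the endomorphism
`Q ↦ Fq(Q) - Q` of `Ẽ(k₀)` is onto. (Lang 1956 / Silverman, *AEC*, Ex. 10.? — in the tree:
the isogeny `1 - φ` is onto `Ẽ(k̄_v)`, `WeierstrassCurve.oneSubFrobeniusIsogeny` with
`Isogeny.surjective`, *AEC* II.2.3; transported along `k₀ ≃ k̄_v`, `IsAlgClosure.equiv`.)
[cite: SilvermanAEC2009, Thm. II.2.3] -/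
theorem exists_map_frob_sub_eq {k : Type u} [Field k] [Finite k] (E : WeierstrassCurve k) [E.IsElliptic]
    {k₀ : Type u} [Field k₀] [Algebra k k₀] [IsAlgClosure k k₀]
    (Fq : k₀ ≃ₐ[k] k₀) (hFq : ∀ x, Fq x = x ^ Nat.card k)
    (P : (E.baseChange k₀).toAffine.Point) :
    ∃ Q : (E.baseChange k₀).toAffine.Point, Affine.Point.map (Fq : k₀ →ₐ[k] k₀) Q - Q = P := by
  obtain ⟨σ, hσ⟩ := exists_frobenius_absoluteGaloisGroup k
  let e : k₀ ≃ₐ[k] AlgebraicClosure k := IsAlgClosure.equiv k k₀ (AlgebraicClosure k)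
  -- the identity `E(k̄) = (E ⊗ k̄)(k̄)` as an additive map, to read Lang's theorem on points
  let ι : geomPoints E →+ (E.baseChange (AlgebraicClosure k)).toAffine.Point := AddMonoidHom.id _
  have hι : ∀ Q : geomPoints E, ι (σ • Q) =
      Affine.Point.map ((absoluteGaloisGroup.toAlgEquiv k σ :
        AlgebraicClosure k ≃ₐ[k] AlgebraicClosure k) : AlgebraicClosure k →ₐ[k] AlgebraicClosure k) (ι Q) :=
    fun _ ↦ rfl
  -- Lang over `k̄`: `Q₂ - σ Q₂ = -e(P)`
  obtain ⟨Q₂, hQ₂⟩ := (E.oneSubFrobeniusIsogeny hσ).surjective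
    (-(show geomPoints E from Affine.Point.map (e : k₀ →ₐ[k] AlgebraicClosure k) P))
  rw [oneSubFrobeniusIsogeny_apply] at hQ₂
  have h := congrArg ι hQ₂
  rw [map_sub, map_neg, hι] at h
  have hιP : ι (show geomPoints E from Affine.Point.map (e : k₀ →ₐ[k] AlgebraicClosure k) P) =
      Affine.Point.map (e : k₀ →ₐ[k] AlgebraicClosure k) P := rfl
  rw [hιP] at h
  set R : (E.baseChange (AlgebraicClosure k)).toAffine.Point := ι Q₂ with hR
  -- `h : R - σ R = -e(P)`, i.e. `σ R - R = e(P)`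
  have hQ₂eq : Affine.Point.map ((absoluteGaloisGroup.toAlgEquiv k σ :
        AlgebraicClosure k ≃ₐ[k] AlgebraicClosure k) : AlgebraicClosure k →ₐ[k] AlgebraicClosure k) R - R
      = Affine.Point.map (e : k₀ →ₐ[k] AlgebraicClosure k) P := by
    rw [← neg_sub, h, neg_neg]
  refine ⟨Affine.Point.map (e.symm : AlgebraicClosure k →ₐ[k] k₀) R, ?_⟩
  apply Affine.Point.map_injective (e : k₀ →ₐ[k] AlgebraicClosure k)
  rw [map_sub]
  simp only [Affine.Point.map_map]
  have h1 : (e : k₀ →ₐ[k] AlgebraicClosure k).comp ((Fq : k₀ →ₐ[k] k₀).comp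
      (e.symm : AlgebraicClosure k →ₐ[k] k₀)) =
      ((absoluteGaloisGroup.toAlgEquiv k σ : AlgebraicClosure k ≃ₐ[k] AlgebraicClosure k) :
        AlgebraicClosure k →ₐ[k] AlgebraicClosure k) := by
    ext y
    change e (Fq (e.symm y)) = σ • y
    rw [hFq, map_pow, AlgEquiv.apply_symm_apply, hσ]
  have h2 : ∀ Q : (E.baseChange (AlgebraicClosure k)).toAffine.Point,
      Affine.Point.map ((e : k₀ →ₐ[k] AlgebraicClosure k).comp
        (e.symm : AlgebraicClosure k →ₐ[k] k₀)) Q = Q := by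
    rintro (_ | ⟨x, y, h⟩)
    · rfl
    · rw [Affine.Point.map_some]
      exact point_some_congr (e.apply_symm_apply x) (e.apply_symm_apply y)
  rw [h1, h2]
  exact hQ₂eq


omit [NumberField K] in
/-- `congrEquiv h ∘ congrEquiv h.symm = id` (transport of points along an equality of Weierstrass
equations, `VariableChangePointsMap`). [folklore] -/
theorem congrEquiv_apply_congrEquiv_symm {F : Type*} [Field F] {W₁ W₂ : WeierstrassCurve F} (h : W₁ = W₂)
    (P : W₂.toAffine.Point) :
    Affine.Point.congrEquiv h (Affine.Point.congrEquiv h.symm P) = P := by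
  subst h
  rfl

/-! ## The residue field `k₀` of `𝒪_w` over `k_v`, its `q`-Frobenius, and the good model over `𝒪_w` -/

section Model

variable {W}
variable {ι : v.adicCompletionIntegers K →+* w.integer}
  (hι : ∀ a, ((ι a : w.integer) : AlgebraicClosure (v.adicCompletion K)) =
    algebraMap (v.adicCompletion K) (AlgebraicClosure (v.adicCompletion K)) (a : v.adicCompletion K))
include hw hι

omit W in
/-- The structure map `ι : 𝓞_v → 𝒪_w` is a local homomorphism (`|a|_v < 1 ⇒ |ι a|_v < 1`).
[folklore] -/
theorem isLocalHom_of_coe_eq : IsLocalHom ι := by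
  refine ⟨fun a ha ↦ ?_⟩
  have hvw : w.Integers w.integer := Valuation.integer.integers w
  have h1 : w ((ι a : w.integer) : AlgebraicClosure (v.adicCompletion K)) = 1 :=
    hvw.isUnit_iff_valuation_eq_one.mp ha
  rw [hι] at h1
  by_contra hna
  obtain ⟨ϖ, hϖ⟩ := IsDiscreteValuationRing.exists_irreducible (v.adicCompletionIntegers K)
  have hmem : a ∈ IsLocalRing.maximalIdeal (v.adicCompletionIntegers K) := hna
  have hle := (mem_maximalIdeal_adicCompletionIntegers_pow_iff hw hϖ a 1).mp (by rwa [pow_one])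
  rw [pow_one, h1] at hle
  exact absurd hle (not_le.mpr (spectralValuation_uniformizer_pos_lt_one hw hϖ).2)

omit W in
/-- Residues along `ι`: `res_w ∘ ι = (k_v → k₀) ∘ res_v` for the induced map of residue fields
`k_v → k₀ = 𝒪_w/𝔪_w` (Mathlib `IsLocalRing.ResidueField.map`). [folklore] -/
theorem residue_comp_eq_map_comp_residue :
    haveI := isLocalHom_of_coe_eq hw hι
    (IsLocalRing.residue w.integer).comp ι =
      (IsLocalRing.ResidueField.map ι).comp (IsLocalRing.residue (v.adicCompletionIntegers K)) := by
  haveI := isLocalHom_of_coe_eq hw hι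
  ext a
  exact (IsLocalRing.ResidueField.map_residue ι a).symm

omit W in
/-- **`k₀ = 𝒪_w/𝔪_w` is algebraic over `k_v`** (every `b ∈ 𝒪_w` is integral over `𝓞_v`, and its
equation reduces to one for `b̄` over `k_v`); with `isAlgClosed_residueField_integer` this makes
`k₀` an algebraic closure of `k_v` (Neukirch, *ANT*, II §9: the residue field of `K̄_v` is `k̄_v`).
[cite: NeukirchANT1999, Ch. II §9 Prop. (9.9)] -/
theorem isAlgebraic_residueField_integer :
    haveI := isLocalHom_of_coe_eq hw hι
    letI : Algebra (IsLocalRing.ResidueField (v.adicCompletionIntegers K)) (IsLocalRing.ResidueField w.integer) :=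
      (IsLocalRing.ResidueField.map ι).toAlgebra
    Algebra.IsAlgebraic (IsLocalRing.ResidueField (v.adicCompletionIntegers K))
      (IsLocalRing.ResidueField w.integer) := by
  haveI := isLocalHom_of_coe_eq hw hι
  letI : Algebra (IsLocalRing.ResidueField (v.adicCompletionIntegers K)) (IsLocalRing.ResidueField w.integer) :=
    (IsLocalRing.ResidueField.map ι).toAlgebra
  have hvw : w.Integers w.integer := Valuation.integer.integers w
  refine ⟨fun γ ↦ ?_⟩
  obtain ⟨b, rfl⟩ := IsLocalRing.residue_surjective γ
  -- `b` is integral over `𝓞_v`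
  have hbint : _root_.IsIntegral (v.adicCompletionIntegers K) (b : AlgebraicClosure (v.adicCompletion K)) := by
    have : (b : AlgebraicClosure (v.adicCompletion K)) ∈ v.localAbsIntegers :=
      (mem_localAbsIntegers_iff_spectralValuation hw).mpr b.2
    exact this
  obtain ⟨q, hq, hqb⟩ := hbint
  -- read the equation in `𝒪_w`, then reduce it
  have hqb' : (q.map ι).eval b = 0 := by
    apply hvw.hom_inj
    rw [map_zero, ← eval_map_algebraMap_integer, Polynomial.map_map]
    have hcomp : (algebraMap w.integer (AlgebraicClosure (v.adicCompletion K))).comp ι =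
        algebraMap (v.adicCompletionIntegers K) (AlgebraicClosure (v.adicCompletion K)) := by
      ext a
      rw [RingHom.comp_apply, IsScalarTower.algebraMap_apply (v.adicCompletionIntegers K)
        (v.adicCompletion K) (AlgebraicClosure (v.adicCompletion K))]
      exact hι a
    rw [hcomp, ← Polynomial.eval₂_eq_eval_map]
    exact hqb
  refine IsIntegral.isAlgebraic (⟨(q.map (IsLocalRing.residue (v.adicCompletionIntegers K))), hq.map _, ?_⟩ :
    _root_.IsIntegral (IsLocalRing.ResidueField (v.adicCompletionIntegers K)) (IsLocalRing.residue w.integer b))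
  rw [Polynomial.eval₂_eq_eval_map, Polynomial.map_map,
    show (algebraMap (IsLocalRing.ResidueField (v.adicCompletionIntegers K))
        (IsLocalRing.ResidueField w.integer)).comp (IsLocalRing.residue (v.adicCompletionIntegers K)) =
      (IsLocalRing.residue w.integer).comp ι from (residue_comp_eq_map_comp_residue hw hι).symm,
    ← Polynomial.map_map, eval_map, eval₂_at_apply, hqb', map_zero]

end Model

/-! ## The inertia-invariant lift and the main theorem -/

section Main

variable {W}

include hw in
set_option maxHeartbeats 1600000 in
/-- **Lang's theorem + Hensel lifting for the good model over `𝒪_w`.** Let `E/K` have good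
reduction at `v`, `M = W.localMinimalIntegralModel v` its minimal (good) model over `𝓞_v`,
`V = M ⊗ K̄_v`, `𝔐` a prime of `\bar 𝓞_v` above `𝓂_v` with inertia group `I_𝔐 ≤ Γ_{K_v}`, and
`φ ∈ Γ_{K_v}` an element inducing the `q_v`-power map modulo `𝔐` on `𝒪_w`
(`|φ z - z^{q_v}|_v < 1` for `|z|_v ≤ 1`: an arithmetic Frobenius). Then for every `m ∈ V(K̄_v)`
there is `b ∈ V(K̄_v)` FIXED BY `I_𝔐` with `m - (φ b - b) ∈ V₁(K̄_v)`, the kernel of reduction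
(`FormalGroupChart.kernel`). Proof: reduce modulo `𝔐` to `Ẽ_v(k₀)`, `k₀ = 𝒪_w/𝔪_w ≅ k̄_v`
(`goodReductionHom`, a homomorphism with kernel `V₁`, *AEC* VII.2.1), where `φ` acts as the
`q_v`-Frobenius `F` and `I_𝔐` acts trivially; by **Lang's theorem** (`1 - F` is onto
`Ẽ_v(k̄_v)`, the tree's `Isogeny.surjective` for `oneSubFrobeniusIsogeny`, *AEC* II.2.3)
`m̃ = F β - β`; lift `β` to an `I_𝔐`-invariant point `b` (Teichmüller lift of one coordinate, Hensel
in the other at a non-vanishing partial derivative, `exists_isRoot_residue_eq_forall`); then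
`\widetilde{m - (φb - b)} = m̃ - (Fβ - β) = Õ`. (Milne, *ADT*, proof of Prop. I.3.8: "Lang's
theorem … Hensel's lemma"; Lang–Tate 1958.)
[cite: MilneADT2006, Ch. I Prop. 3.8 (proof)] [cite: SilvermanAEC2009, Thm. II.2.3 and Prop. VII.2.1] -/
theorem exists_lift_sub_mem_kernel [W.IsElliptic] (hv : W.HasGoodReductionAt v)
    {𝔐 : Ideal v.localAbsIntegers} (h𝔐 : 𝔐 ∈ v.localPrimesAbove)
    [hV : (((W.localMinimalIntegralModel v).map
        (algebraMap (v.adicCompletionIntegers K) (v.adicCompletion K))).baseChange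
        (AlgebraicClosure (v.adicCompletion K))).IsIntegral w.integer]
    {φ : absoluteGaloisGroup (v.adicCompletion K)}
    (hφq : ∀ z : AlgebraicClosure (v.adicCompletion K), w z ≤ 1 →
      w (absoluteGaloisGroup.toAlgEquiv (v.adicCompletion K) φ z -
        z ^ Nat.card (IsLocalRing.ResidueField (v.adicCompletionIntegers K))) < 1)
    (m : (((W.localMinimalIntegralModel v).map
        (algebraMap (v.adicCompletionIntegers K) (v.adicCompletion K))).baseChange
        (AlgebraicClosure (v.adicCompletion K))).toAffine.Point) :
    ∃ b : (((W.localMinimalIntegralModel v).map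
        (algebraMap (v.adicCompletionIntegers K) (v.adicCompletion K))).baseChange
        (AlgebraicClosure (v.adicCompletion K))).toAffine.Point,
      (∀ τ ∈ 𝔐.inertia (absoluteGaloisGroup (v.adicCompletion K)),
        Affine.Point.map ((absoluteGaloisGroup.toAlgEquiv (v.adicCompletion K) τ :
          AlgebraicClosure (v.adicCompletion K) ≃ₐ[v.adicCompletion K] AlgebraicClosure (v.adicCompletion K)) :
          AlgebraicClosure (v.adicCompletion K) →ₐ[v.adicCompletion K] AlgebraicClosure (v.adicCompletion K)) b = b) ∧
      m - (Affine.Point.map ((absoluteGaloisGroup.toAlgEquiv (v.adicCompletion K) φ :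
          AlgebraicClosure (v.adicCompletion K) ≃ₐ[v.adicCompletion K] AlgebraicClosure (v.adicCompletion K)) :
          AlgebraicClosure (v.adicCompletion K) →ₐ[v.adicCompletion K] AlgebraicClosure (v.adicCompletion K)) b - b)
        ∈ FormalGroupChart.kernel w (((W.localMinimalIntegralModel v).map
            (algebraMap (v.adicCompletionIntegers K) (v.adicCompletion K))).baseChange
            (AlgebraicClosure (v.adicCompletion K))) := by
  -- notation (as `have`/`let`-free abbreviations we use the full names; `M`, `X` below are terms)
  have hvw : w.Integers w.integer := Valuation.integer.integers w
  have hφw : ∀ z, w (absoluteGaloisGroup.toAlgEquiv (v.adicCompletion K) φ z) = w z :=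
    fun z ↦ spectralValuation_smul hw φ z
  -- trivial case: `m ∈ V₁`
  by_cases hm : m ∈ FormalGroupChart.kernel w (((W.localMinimalIntegralModel v).map
      (algebraMap (v.adicCompletionIntegers K) (v.adicCompletion K))).baseChange (AlgebraicClosure (v.adicCompletion K)))
  · refine ⟨0, fun τ _ ↦ by rw [map_zero], ?_⟩
    rwa [map_zero, sub_self, sub_zero]
  -- the model over `𝒪_w`
  obtain ⟨ι, hι⟩ := exists_ringHom_adicCompletionIntegers_integer (v := v) hw
  haveI hιloc := isLocalHom_of_coe_eq hw hι
  set W₀ : WeierstrassCurve w.integer := (W.localMinimalIntegralModel v).map ι with hW₀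
  have hcompL : (algebraMap w.integer (AlgebraicClosure (v.adicCompletion K))).comp ι =
      (algebraMap (v.adicCompletion K) (AlgebraicClosure (v.adicCompletion K))).comp
        (algebraMap (v.adicCompletionIntegers K) (v.adicCompletion K)) := by
    ext a
    exact hι a
  have hX : ((W.localMinimalIntegralModel v).map (algebraMap (v.adicCompletionIntegers K) (v.adicCompletion K))).baseChange
      (AlgebraicClosure (v.adicCompletion K)) = W₀.baseChange (AlgebraicClosure (v.adicCompletion K)) := by
    simp only [baseChange, hW₀, map_map, hcompL]
  have hΔ₀ : IsUnit W₀.Δ := by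
    rw [hW₀, map_Δ]; exact (isUnit_Δ_localMinimalIntegralModel hv).map ι
  haveI hW₀ell : (W₀.map (IsLocalRing.residue w.integer)).IsElliptic := isElliptic_map_residue hΔ₀
  -- the reduction homomorphism `V(K̄_v) → Ẽ(k₀)` and its kernel
  set red : (((W.localMinimalIntegralModel v).map (algebraMap (v.adicCompletionIntegers K) (v.adicCompletion K))).baseChange
      (AlgebraicClosure (v.adicCompletion K))).toAffine.Point →+
      (W₀.map (IsLocalRing.residue w.integer)).toAffine.Point :=
    (goodReductionHom W₀ hvw hΔ₀).comp (Affine.Point.congrEquiv hX).toAddMonoidHom with hred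
  have hred_apply : ∀ P, red P = W₀.reducePoint (Affine.Point.congrEquiv hX P) := fun _ ↦ rfl
  have hred0 : ∀ P, red P = 0 ↔ P ∈ FormalGroupChart.kernel w (((W.localMinimalIntegralModel v).map (algebraMap (v.adicCompletionIntegers K)
      (v.adicCompletion K))).baseChange (AlgebraicClosure (v.adicCompletion K))) := by
    intro P
    rw [hred_apply, ← goodReductionHom_apply hvw hΔ₀, goodReductionHom_eq_zero_iff]
    rcases P with _ | ⟨x, y, h⟩
    · rw [← Affine.Point.zero_def, map_zero]
      exact iff_of_true WeierstrassCurve.reducesToZero_zero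
        (fun he ↦ (Affine.Point.some_ne_zero _ he.symm).elim)
    · rw [Affine.Point.congrEquiv_some, WeierstrassCurve.reducesToZero_some_iff,
        not_mem_range_iff hvw, FormalGroupChart.some_mem_kernel_iff]
  -- integral points and their reductions
  have hred_some : ∀ (x y : AlgebraicClosure (v.adicCompletion K)) (hx : w x ≤ 1) (hy : w y ≤ 1)
      (h : (((W.localMinimalIntegralModel v).map (algebraMap (v.adicCompletionIntegers K)
        (v.adicCompletion K))).baseChange (AlgebraicClosure (v.adicCompletion K))).toAffine.Nonsingular x y),
      ∃ hns, red (.some _ _ h) =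
        .some (IsLocalRing.residue w.integer ⟨x, hx⟩) (IsLocalRing.residue w.integer ⟨y, hy⟩) hns := by
    intro x y hx hy h
    have hh : (W₀.baseChange (AlgebraicClosure (v.adicCompletion K))).toAffine.Nonsingular
        (algebraMap w.integer _ ⟨x, hx⟩) (algebraMap w.integer _ ⟨y, hy⟩) := by
      have := h; rw [hX] at this; exact this
    have hns : (W₀.map (IsLocalRing.residue w.integer)).toAffine.Nonsingular
        (IsLocalRing.residue w.integer ⟨x, hx⟩) (IsLocalRing.residue w.integer ⟨y, hy⟩) := by
      rw [← Affine.equation_iff_nonsingular]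
      exact (Affine.Equation.map (IsLocalRing.residue w.integer)
        ((map_equation_iff hvw.hom_inj).mp hh.1) : _)
    refine ⟨hns, ?_⟩
    rw [hred_apply, Affine.Point.congrEquiv_some]
    change W₀.reducePoint (.some _ _ hh) = _
    rw [reducePoint_some_algebraMap hvw.hom_inj hh]
  have hred_E1 : ∀ (x y : AlgebraicClosure (v.adicCompletion K))
      (h : (((W.localMinimalIntegralModel v).map (algebraMap (v.adicCompletionIntegers K)
        (v.adicCompletion K))).baseChange (AlgebraicClosure (v.adicCompletion K))).toAffine.Nonsingular x y),
      1 < w x → red (.some _ _ h) = 0 := fun x y h hx ↦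
    (hred0 _).mpr (FormalGroupChart.some_mem_kernel h hx)
  -- (R2) inertia acts trivially on reductions
  have hredI : ∀ τ ∈ 𝔐.inertia (absoluteGaloisGroup (v.adicCompletion K)), ∀ P,
      red (Affine.Point.map ((absoluteGaloisGroup.toAlgEquiv (v.adicCompletion K) τ :
          AlgebraicClosure (v.adicCompletion K) ≃ₐ[v.adicCompletion K] AlgebraicClosure (v.adicCompletion K)) :
          AlgebraicClosure (v.adicCompletion K) →ₐ[v.adicCompletion K] AlgebraicClosure (v.adicCompletion K)) P)
        = red P := by
    intro τ hτ P
    rw [hred_apply, hred_apply]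
    exact W₀.reducePoint_congrEquiv_map_eq hX _ (fun z ↦ spectralValuation_smul hw τ z)
      ((mem_inertia_iff_spectralValuation hw h𝔐).mp hτ) P
  -- the subring of `𝒪_w` fixed by `I_𝔐`
  let S : Subring w.integer :=
    { carrier := {z | ∀ τ ∈ 𝔐.inertia (absoluteGaloisGroup (v.adicCompletion K)),
        absoluteGaloisGroup.toAlgEquiv (v.adicCompletion K) τ (z : AlgebraicClosure (v.adicCompletion K)) = z}
      one_mem' := fun τ _ ↦ by simp
      zero_mem' := fun τ _ ↦ by simp
      add_mem' := fun {a b} ha hb τ hτ ↦ by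
        simp only [Set.mem_setOf_eq] at ha hb
        rw [Subring.coe_add, map_add, ha τ hτ, hb τ hτ]
      mul_mem' := fun {a b} ha hb τ hτ ↦ by
        simp only [Set.mem_setOf_eq] at ha hb
        rw [Subring.coe_mul, map_mul, ha τ hτ, hb τ hτ]
      neg_mem' := fun {a} ha τ hτ ↦ by
        simp only [Set.mem_setOf_eq] at ha
        rw [Subring.coe_neg, map_neg, ha τ hτ] }
  have hSmem : ∀ z : w.integer, z ∈ S ↔ ∀ τ ∈ 𝔐.inertia (absoluteGaloisGroup (v.adicCompletion K)),
      absoluteGaloisGroup.toAlgEquiv (v.adicCompletion K) τ (z : AlgebraicClosure (v.adicCompletion K)) = z :=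
    fun _ ↦ Iff.rfl
  have hιS : ∀ c : v.adicCompletionIntegers K, ι c ∈ S := fun c τ _ ↦ by
    rw [hι]; exact AlgEquiv.commutes _ _
  have ha₁S : W₀.a₁ ∈ S := by rw [hW₀, map_a₁]; exact hιS _
  have ha₂S : W₀.a₂ ∈ S := by rw [hW₀, map_a₂]; exact hιS _
  have ha₃S : W₀.a₃ ∈ S := by rw [hW₀, map_a₃]; exact hιS _
  have ha₄S : W₀.a₄ ∈ S := by rw [hW₀, map_a₄]; exact hιS _
  have ha₆S : W₀.a₆ ∈ S := by rw [hW₀, map_a₆]; exact hιS _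
  -- the residue fields `k = k_v ⊆ k₀ = 𝒪_w/𝔪_w`, `q = #k`, the `q`-Frobenius of `k₀`
  letI algk : Algebra (IsLocalRing.ResidueField (v.adicCompletionIntegers K))
      (IsLocalRing.ResidueField w.integer) := (IsLocalRing.ResidueField.map ι).toAlgebra
  haveI : Finite (IsLocalRing.ResidueField (v.adicCompletionIntegers K)) :=
    finite_residueField_adicCompletionIntegers K v
  letI := Fintype.ofFinite (IsLocalRing.ResidueField (v.adicCompletionIntegers K))
  obtain ⟨p, hchar, n, hp, hcard⟩ := FiniteField.card' (IsLocalRing.ResidueField (v.adicCompletionIntegers K))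
  haveI : CharP (IsLocalRing.ResidueField (v.adicCompletionIntegers K)) p := hchar
  haveI hcharp : CharP (IsLocalRing.ResidueField w.integer) p :=
    charP_of_injective_algebraMap (algebraMap (IsLocalRing.ResidueField (v.adicCompletionIntegers K))
      (IsLocalRing.ResidueField w.integer)).injective p
  haveI : Fact p.Prime := ⟨hp⟩
  haveI : ExpChar (IsLocalRing.ResidueField w.integer) p := ExpChar.prime hp
  haveI : IsAlgClosed (IsLocalRing.ResidueField w.integer) := isAlgClosed_residueField_integer w
  haveI : PerfectField (IsLocalRing.ResidueField w.integer) := IsAlgClosed.perfectField _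
  have hq : Nat.card (IsLocalRing.ResidueField (v.adicCompletionIntegers K)) = p ^ (n : ℕ) := by
    rw [Nat.card_eq_fintype_card, hcard]
  let Fq : IsLocalRing.ResidueField w.integer ≃+* IsLocalRing.ResidueField w.integer :=
    iterateFrobeniusEquiv (IsLocalRing.ResidueField w.integer) p n
  have hFq : ∀ x, Fq x = x ^ Nat.card (IsLocalRing.ResidueField (v.adicCompletionIntegers K)) :=
    fun x ↦ by rw [hq]; exact iterateFrobeniusEquiv_apply _ p n x
  have hFqk : ∀ c : IsLocalRing.ResidueField (v.adicCompletionIntegers K),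
      Fq (algebraMap _ (IsLocalRing.ResidueField w.integer) c) = algebraMap _ _ c := fun c ↦ by
    rw [hFq, ← map_pow, Nat.card_eq_fintype_card, FiniteField.pow_card]
  let Fqa : IsLocalRing.ResidueField w.integer ≃ₐ[IsLocalRing.ResidueField (v.adicCompletionIntegers K)]
      IsLocalRing.ResidueField w.integer := { Fq with commutes' := hFqk }
  have hFqa : ∀ x, Fqa x = x ^ Nat.card (IsLocalRing.ResidueField (v.adicCompletionIntegers K)) := hFq
  haveI : Algebra.IsAlgebraic (IsLocalRing.ResidueField (v.adicCompletionIntegers K))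
      (IsLocalRing.ResidueField w.integer) := isAlgebraic_residueField_integer hw hι
  haveI : IsAlgClosure (IsLocalRing.ResidueField (v.adicCompletionIntegers K))
      (IsLocalRing.ResidueField w.integer) := IsAlgClosure.mk inferInstance inferInstance
  -- the reduced equation is `Ẽ_v ⊗ k₀`
  have hWt : W₀.map (IsLocalRing.residue w.integer) =
      (W.reductionAt v).baseChange (IsLocalRing.ResidueField w.integer) := by
    rw [reductionAt_eq_map_residue, baseChange, map_map, map_map]
    congr 1
  haveI := isElliptic_reductionAt hv
  -- residues of `q`-th power congruent elements
  have hresφ : ∀ (z x' : AlgebraicClosure (v.adicCompletion K)) (hz : w z ≤ 1) (hx' : w x' ≤ 1),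
      w (x' - z ^ Nat.card (IsLocalRing.ResidueField (v.adicCompletionIntegers K))) < 1 →
      IsLocalRing.residue w.integer ⟨x', hx'⟩ = Fqa (IsLocalRing.residue w.integer ⟨z, hz⟩) := by
    intro z x' hz hx' hcong
    rw [hFqa, ← map_pow]
    have hzq : w (z ^ Nat.card (IsLocalRing.ResidueField (v.adicCompletionIntegers K))) ≤ 1 := by
      rw [map_pow]; exact pow_le_one₀ zero_le hz
    rw [WeierstrassCurve.residue_eq_of_val_sub_lt_one (w := w) hzq hx' hcong]
    rfl
  -- (R3) `φ` reduces to the `q`-Frobenius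
  have hredφ : ∀ P, red (Affine.Point.map ((absoluteGaloisGroup.toAlgEquiv (v.adicCompletion K) φ :
          AlgebraicClosure (v.adicCompletion K) ≃ₐ[v.adicCompletion K] AlgebraicClosure (v.adicCompletion K)) :
          AlgebraicClosure (v.adicCompletion K) →ₐ[v.adicCompletion K] AlgebraicClosure (v.adicCompletion K)) P)
        = Affine.Point.congrEquiv hWt.symm (Affine.Point.map
            (Fqa : IsLocalRing.ResidueField w.integer →ₐ[IsLocalRing.ResidueField (v.adicCompletionIntegers K)]
              IsLocalRing.ResidueField w.integer) (Affine.Point.congrEquiv hWt (red P))) := by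
    intro P
    rcases P with _ | ⟨x, y, h⟩
    · rw [← Affine.Point.zero_def]
      simp only [map_zero]
    · by_cases hx : w x ≤ 1
      · have hy : w y ≤ 1 := val_y_le_one h.1 hx
        have hφx : w (((absoluteGaloisGroup.toAlgEquiv (v.adicCompletion K) φ :
          AlgebraicClosure (v.adicCompletion K) ≃ₐ[v.adicCompletion K] AlgebraicClosure (v.adicCompletion K)) :
          AlgebraicClosure (v.adicCompletion K) →ₐ[v.adicCompletion K] AlgebraicClosure (v.adicCompletion K)) x) ≤ 1 := by
          change w (absoluteGaloisGroup.toAlgEquiv (v.adicCompletion K) φ x) ≤ 1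
          rw [hφw]; exact hx
        have hφy : w (((absoluteGaloisGroup.toAlgEquiv (v.adicCompletion K) φ :
          AlgebraicClosure (v.adicCompletion K) ≃ₐ[v.adicCompletion K] AlgebraicClosure (v.adicCompletion K)) :
          AlgebraicClosure (v.adicCompletion K) →ₐ[v.adicCompletion K] AlgebraicClosure (v.adicCompletion K)) y) ≤ 1 := by
          change w (absoluteGaloisGroup.toAlgEquiv (v.adicCompletion K) φ y) ≤ 1
          rw [hφw]; exact hy
        generalize hP' : Affine.Point.map ((absoluteGaloisGroup.toAlgEquiv (v.adicCompletion K) φ :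
          AlgebraicClosure (v.adicCompletion K) ≃ₐ[v.adicCompletion K] AlgebraicClosure (v.adicCompletion K)) :
          AlgebraicClosure (v.adicCompletion K) →ₐ[v.adicCompletion K] AlgebraicClosure (v.adicCompletion K))
          (.some x y h) = P'
        rcases P' with _ | ⟨x', y', h'⟩
        · rw [Affine.Point.map_some] at hP'
          exact (Affine.Point.some_ne_zero _ hP').elim
        rw [Affine.Point.map_some] at hP'
        simp only [Affine.Point.some.injEq] at hP'
        obtain ⟨rfl, rfl⟩ := hP'
        obtain ⟨hns₁, e₁⟩ := hred_some _ _ hφx hφy h'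
        obtain ⟨hns₂, e₂⟩ := hred_some x y hx hy h
        rw [e₁, e₂, Affine.Point.congrEquiv_some, Affine.Point.map_some, Affine.Point.congrEquiv_some]
        exact point_some_eq_some (hresφ x _ hx hφx (by exact hφq x hx)) (hresφ y _ hy hφy (by exact hφq y hy))
      · have hx' : 1 < w x := not_le.mp hx
        have hφx' : 1 < w (((absoluteGaloisGroup.toAlgEquiv (v.adicCompletion K) φ :
          AlgebraicClosure (v.adicCompletion K) ≃ₐ[v.adicCompletion K] AlgebraicClosure (v.adicCompletion K)) :
          AlgebraicClosure (v.adicCompletion K) →ₐ[v.adicCompletion K] AlgebraicClosure (v.adicCompletion K)) x) := by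
          change 1 < w (absoluteGaloisGroup.toAlgEquiv (v.adicCompletion K) φ x)
          rw [hφw]; exact hx'
        generalize hP' : Affine.Point.map ((absoluteGaloisGroup.toAlgEquiv (v.adicCompletion K) φ :
          AlgebraicClosure (v.adicCompletion K) ≃ₐ[v.adicCompletion K] AlgebraicClosure (v.adicCompletion K)) :
          AlgebraicClosure (v.adicCompletion K) →ₐ[v.adicCompletion K] AlgebraicClosure (v.adicCompletion K))
          (.some x y h) = P'
        rcases P' with _ | ⟨x', y', h'⟩
        · rw [Affine.Point.map_some] at hP'
          exact (Affine.Point.some_ne_zero _ hP').elim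
        rw [Affine.Point.map_some] at hP'
        simp only [Affine.Point.some.injEq] at hP'
        obtain ⟨rfl, rfl⟩ := hP'
        rw [hred_E1 _ _ h' hφx', hred_E1 x y h hx']
        simp only [map_zero]
  -- (R4) Lang's theorem: `\tilde m = F β - β`
  obtain ⟨Q₁, hQ₁⟩ := exists_map_frob_sub_eq (W.reductionAt v) Fqa hFqa (Affine.Point.congrEquiv hWt (red m))
  set Q : (W₀.map (IsLocalRing.residue w.integer)).toAffine.Point := Affine.Point.congrEquiv hWt.symm Q₁ with hQdef
  have hQ₁' : Q₁ = Affine.Point.congrEquiv hWt Q := by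
    rw [hQdef, congrEquiv_apply_congrEquiv_symm]
  have hm0 : red m ≠ 0 := fun h0 ↦ hm ((hred0 m).mp h0)
  have hQ0 : Q ≠ 0 := by
    intro hQ0
    apply hm0
    rw [hQ0, map_zero] at hQ₁'
    rw [hQ₁', map_zero, sub_self] at hQ₁
    exact (Affine.Point.congrEquiv hWt).injective (by rw [← hQ₁, map_zero])
  -- (R5) an `I_𝔐`-invariant integral lift `(a, b)` of `Q = (α₀, β₀)`
  haveI hVell : (((W.localMinimalIntegralModel v).map (algebraMap (v.adicCompletionIntegers K) (v.adicCompletion K))).baseChange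
      (AlgebraicClosure (v.adicCompletion K))).IsElliptic := by
    rw [hX, isElliptic_iff, baseChange, map_Δ]
    exact (hΔ₀.map _)
  have hWeq : ∀ a b : w.integer, W₀.toAffine.Equation a b →
      (((W.localMinimalIntegralModel v).map (algebraMap (v.adicCompletionIntegers K) (v.adicCompletion K))).baseChange
        (AlgebraicClosure (v.adicCompletion K))).toAffine.Nonsingular
        (a : AlgebraicClosure (v.adicCompletion K)) (b : AlgebraicClosure (v.adicCompletion K)) := by
    intro a b hab
    rw [← Affine.equation_iff_nonsingular, hX]
    exact (map_equation_iff hvw.hom_inj).mpr hab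
  have lift : ∃ (a b : w.integer) (hL : (((W.localMinimalIntegralModel v).map (algebraMap (v.adicCompletionIntegers K)
      (v.adicCompletion K))).baseChange (AlgebraicClosure (v.adicCompletion K))).toAffine.Nonsingular
        (a : AlgebraicClosure (v.adicCompletion K)) (b : AlgebraicClosure (v.adicCompletion K))),
      red (.some _ _ hL) = Q ∧ a ∈ S ∧ b ∈ S := by
    clear_value Q
    rcases Q with _ | ⟨α₀, β₀, hns⟩
    · exact (hQ0 rfl).elim
    obtain ⟨heq, hpart⟩ := (Affine.nonsingular_iff' _ _).mp hns
    rw [Affine.equation_iff] at heq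
    have ea₁ : (W₀.map (IsLocalRing.residue w.integer)).toAffine.a₁ = IsLocalRing.residue w.integer W₀.a₁ := rfl
    have ea₂ : (W₀.map (IsLocalRing.residue w.integer)).toAffine.a₂ = IsLocalRing.residue w.integer W₀.a₂ := rfl
    have ea₃ : (W₀.map (IsLocalRing.residue w.integer)).toAffine.a₃ = IsLocalRing.residue w.integer W₀.a₃ := rfl
    have ea₄ : (W₀.map (IsLocalRing.residue w.integer)).toAffine.a₄ = IsLocalRing.residue w.integer W₀.a₄ := rfl
    have ea₆ : (W₀.map (IsLocalRing.residue w.integer)).toAffine.a₆ = IsLocalRing.residue w.integer W₀.a₆ := rfl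
    rw [ea₁, ea₂, ea₃, ea₄, ea₆] at heq
    rw [ea₁, ea₂, ea₃, ea₄] at hpart
    by_cases hY : 2 * β₀ + IsLocalRing.residue w.integer W₀.a₁ * α₀ + IsLocalRing.residue w.integer W₀.a₃ ≠ 0
    · -- lift `α₀` invariantly, solve the monic quadratic in `Y` by Hensel
      obtain ⟨a, ha, haI⟩ := exists_residue_eq_forall_inertia hw h𝔐 α₀
      have haS : a ∈ S := haI
      set c₁ : w.integer := W₀.a₁ * a + W₀.a₃ with hc₁
      set c₀ : w.integer := a ^ 3 + W₀.a₂ * a ^ 2 + W₀.a₄ * a + W₀.a₆ with hc₀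
      have hc₁S : c₁ ∈ S := S.add_mem (S.mul_mem ha₁S haS) ha₃S
      have hc₀S : c₀ ∈ S := S.add_mem (S.add_mem (S.add_mem (S.pow_mem haS 3)
        (S.mul_mem ha₂S (S.pow_mem haS 2))) (S.mul_mem ha₄S haS)) ha₆S
      set f : (w.integer)[X] := X ^ 2 + C c₁ * X - C c₀ with hf
      have hfmonic : f.Monic := by
        rw [hf, sub_eq_add_neg, add_assoc]
        refine (monic_X_pow 2).add_of_left ?_
        refine (degree_add_le _ _).trans_lt (max_lt ?_ ?_)
        · exact (degree_C_mul_X_le _).trans_lt (by rw [degree_X_pow]; norm_num)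
        · rw [degree_neg]; exact (degree_C_le).trans_lt (by rw [degree_X_pow]; norm_num)
      have hfcoeff : ∀ i, f.coeff i ∈ S := by
        intro i
        rw [hf]
        simp only [coeff_add, coeff_sub, coeff_X_pow, coeff_C_mul, coeff_X, coeff_C]
        refine S.sub_mem (S.add_mem ?_ (S.mul_mem hc₁S ?_)) ?_
        · split_ifs
          · exact S.one_mem
          · exact S.zero_mem
        · split_ifs
          · exact S.one_mem
          · exact S.zero_mem
        · split_ifs
          · exact hc₀S
          · exact S.zero_mem
      have hroot : (f.map (IsLocalRing.residue w.integer)).IsRoot β₀ := by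
        rw [IsRoot.def, eval_map, hf]
        simp only [eval₂_add, eval₂_sub, eval₂_mul, eval₂_pow, eval₂_C, eval₂_X, hc₁, hc₀, map_add,
          map_mul, map_pow, ha]
        linear_combination heq
      have hder : (f.map (IsLocalRing.residue w.integer)).derivative.eval β₀ ≠ 0 := by
        have : (f.map (IsLocalRing.residue w.integer)).derivative.eval β₀ =
            2 * β₀ + IsLocalRing.residue w.integer W₀.a₁ * α₀ + IsLocalRing.residue w.integer W₀.a₃ := by
          rw [derivative_map, eval_map, hf]
          simp only [derivative_sub, derivative_X_pow, derivative_mul, derivative_C,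
            derivative_X, zero_mul, zero_add, mul_one, sub_zero, eval₂_add, eval₂_mul, eval₂_ofNat,
            mul_zero, add_zero, eval₂_C, eval₂_X, hc₁, map_add, map_mul, ha, map_ofNat, Nat.cast_ofNat,
            pow_one, Nat.add_one_sub_one]
          ring
        rw [this]; exact hY
      obtain ⟨b, hb, hbβ, hbI⟩ := exists_isRoot_residue_eq_forall (v := v) f hfmonic β₀ hroot hder
      have hbS : b ∈ S := fun τ hτ ↦ hbI _ (fun z ↦ spectralValuation_smul hw τ z)
        ((mem_inertia_iff_spectralValuation hw h𝔐).mp hτ) (fun i ↦ hfcoeff i τ hτ)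
      have hWab : W₀.toAffine.Equation a b := by
        rw [Affine.equation_iff]
        rw [IsRoot.def, hf] at hb
        simp only [eval_add, eval_sub, eval_mul, eval_pow, eval_X, eval_C, hc₁, hc₀] at hb
        linear_combination hb
      obtain ⟨hns', e'⟩ := hred_some _ _ a.2 b.2 (hWeq a b hWab)
      refine ⟨a, b, hWeq a b hWab, ?_, haS, hbS⟩
      rw [e']
      exact point_some_eq_some (by simpa only [Subtype.coe_eta] using ha)
        (by simpa only [Subtype.coe_eta] using hbβ)
    · -- lift `β₀` invariantly, solve the monic cubic in `X` by Hensel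
      have hXp : IsLocalRing.residue w.integer W₀.a₁ * β₀ -
          (3 * α₀ ^ 2 + 2 * IsLocalRing.residue w.integer W₀.a₂ * α₀ + IsLocalRing.residue w.integer W₀.a₄) ≠ 0 := by
        rw [not_not] at hY
        exact hpart.resolve_right (by rw [hY]; exact not_not.mpr rfl)
      obtain ⟨b, hb, hbI⟩ := exists_residue_eq_forall_inertia hw h𝔐 β₀
      have hbS : b ∈ S := hbI
      set c₂ : w.integer := W₀.a₂ with hc₂
      set c₁ : w.integer := W₀.a₄ - W₀.a₁ * b with hc₁
      set c₀ : w.integer := W₀.a₆ - b ^ 2 - W₀.a₃ * b with hc₀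
      have hc₂S : c₂ ∈ S := ha₂S
      have hc₁S : c₁ ∈ S := S.sub_mem ha₄S (S.mul_mem ha₁S hbS)
      have hc₀S : c₀ ∈ S := S.sub_mem (S.sub_mem ha₆S (S.pow_mem hbS 2)) (S.mul_mem ha₃S hbS)
      set g : (w.integer)[X] := X ^ 3 + C c₂ * X ^ 2 + C c₁ * X + C c₀ with hg
      have hgmonic : g.Monic := by
        rw [hg, add_assoc, add_assoc]
        refine (monic_X_pow 3).add_of_left ?_
        refine (degree_add_le _ _).trans_lt (max_lt ?_ ((degree_add_le _ _).trans_lt (max_lt ?_ ?_)))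
        · exact (degree_C_mul_X_pow_le 2 _).trans_lt (by rw [degree_X_pow]; norm_num)
        · exact (degree_C_mul_X_le _).trans_lt (by rw [degree_X_pow]; norm_num)
        · exact (degree_C_le).trans_lt (by rw [degree_X_pow]; norm_num)
      have hgcoeff : ∀ i, g.coeff i ∈ S := by
        intro i
        rw [hg]
        simp only [coeff_add, coeff_X_pow, coeff_C_mul, coeff_X, coeff_C]
        refine S.add_mem (S.add_mem (S.add_mem ?_ (S.mul_mem hc₂S ?_)) (S.mul_mem hc₁S ?_)) ?_
        · split_ifs
          · exact S.one_mem
          · exact S.zero_mem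
        · split_ifs
          · exact S.one_mem
          · exact S.zero_mem
        · split_ifs
          · exact S.one_mem
          · exact S.zero_mem
        · split_ifs
          · exact hc₀S
          · exact S.zero_mem
      have hroot : (g.map (IsLocalRing.residue w.integer)).IsRoot α₀ := by
        rw [IsRoot.def, eval_map, hg]
        simp only [eval₂_add, eval₂_sub, eval₂_mul, eval₂_pow, eval₂_C, eval₂_X, hc₂, hc₁, hc₀,
          map_sub, map_mul, map_pow, hb]
        linear_combination -heq
      have hder : (g.map (IsLocalRing.residue w.integer)).derivative.eval α₀ ≠ 0 := by
        have : (g.map (IsLocalRing.residue w.integer)).derivative.eval α₀ =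
            -(IsLocalRing.residue w.integer W₀.a₁ * β₀ -
              (3 * α₀ ^ 2 + 2 * IsLocalRing.residue w.integer W₀.a₂ * α₀ + IsLocalRing.residue w.integer W₀.a₄)) := by
          rw [derivative_map, eval_map, hg]
          simp only [derivative_add, derivative_X_pow, derivative_mul, derivative_C,
            derivative_X, zero_mul, zero_add, mul_one, add_zero, eval₂_add, eval₂_sub, eval₂_mul, eval₂_ofNat,
            mul_zero, sub_zero, eval₂_C, eval₂_X, eval₂_pow, hc₂, hc₁, map_sub, map_mul, hb, map_ofNat,
            Nat.cast_ofNat, pow_one, Nat.add_one_sub_one]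
          ring
        rw [this, neg_ne_zero]; exact hXp
      obtain ⟨a, ha, haα, haI⟩ := exists_isRoot_residue_eq_forall (v := v) g hgmonic α₀ hroot hder
      have haS : a ∈ S := fun τ hτ ↦ haI _ (fun z ↦ spectralValuation_smul hw τ z)
        ((mem_inertia_iff_spectralValuation hw h𝔐).mp hτ) (fun i ↦ hgcoeff i τ hτ)
      have hWab : W₀.toAffine.Equation a b := by
        rw [Affine.equation_iff]
        rw [IsRoot.def, hg] at ha
        simp only [eval_add, eval_mul, eval_pow, eval_X, eval_C, hc₂, hc₁, hc₀] at ha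
        linear_combination -ha
      obtain ⟨hns', e'⟩ := hred_some _ _ a.2 b.2 (hWeq a b hWab)
      refine ⟨a, b, hWeq a b hWab, ?_, haS, hbS⟩
      rw [e']
      exact point_some_eq_some (by simpa only [Subtype.coe_eta] using haα)
        (by simpa only [Subtype.coe_eta] using hb)
  -- (R6) conclusion
  obtain ⟨a, b, hL, hredb, haS, hbS⟩ := lift
  refine ⟨.some _ _ hL, fun τ hτ ↦ ?_, ?_⟩
  · rw [Affine.Point.map_some]
    exact point_some_eq_some (haS τ hτ) (hbS τ hτ)
  · rw [← hred0, map_sub, map_sub, hredφ, hredb]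
    apply (Affine.Point.congrEquiv hWt).injective
    rw [map_zero, map_sub, map_sub, congrEquiv_apply_congrEquiv_symm, ← hQ₁', hQ₁, sub_self]

end Main

end WeierstrassCurve
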